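import Summits.ValiantsHypothesis.ValiantsHypothesis.Theses.UlrichPadded
import Literature.Computability.AlgebraicComplexity.PermanentIrreducible
import Literature.RingTheory.RegularLocalRing.GradedFactorialProofs
import Literature.RingTheory.GradedAlgebra.QuotientGrading

/-!
# Crux `PermHypersurfaceFactorial` (stmt-ValiantsHypothesis-5666), line `derivation-symbolic-square`
— stub 4 `stub_gradedDescent`: locally factorial at the maximal ideals ⇒ `S_n` factorial

For `n ≥ 3` (indeed `n ≥ 1`) the permanental hypersurface ring
`S_n = ℂ[x_{n×n}] ⧸ (per_n)` is a noetherian domain (`per_n` is irreducible, hence prime, in the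
UFD `ℂ[x]`: `perPoly_irreducible`), graded by total degree: `(per_n)` is generated by a form of
degree `n` (`perPoly_isHomogeneous`), so it is a homogeneous ideal for Mathlib's
`MvPolynomial.gradedAlgebra`, and the quotient inherits the grading
(`Literature.RingTheory.GradedAlgebra.quotGrading`, `quotGrading.gradedAlgebra`). Its degree-`0`
part is the image of `ℂ`, a field.

**Graded descent (Fossum 1973, Cor. 10.3).** For a noetherian `ℕ`-graded domain `A` whose
degree-`0` part is a field, the irrelevant ideal `A₊` is maximal (`x ∉ A₊` has a unit constant
term `x₀`, and `x - x₀ ∈ A₊`), and `A` is factorial as soon as `A_{A₊}` is — the tree's PROVED,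
normality-free form
`Literature.RingTheory.RegularLocalRing.uniqueFactorizationMonoid_of_atIrrelevant` of Fossum's
corollary. Hence: if `(S_n)_M` is factorial for every maximal ideal `M` of `S_n`, then
`S_n` is factorial (`stub_gradedDescent`).

The tree's theorem is stated for gradings by additive subgroups `𝒜 : ℕ → AddSubgroup A`; the
quotient grading is by `ℂ`-submodules. `permQuot_ufm_of_gradedAlgebra` re-bundles a grading by
submodules as the same grading by additive subgroups (same carriers, same decomposition) and
performs the descent; `permQuot_irrelevant_isMaximal` is the maximality of `A₊`.
-/

noncomputable section

namespace Summit.ValiantsHypothesis.Theorems.PermHypersurfaceFactorial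

open MvPolynomial IsLocalRing Literature.Computability.AlgebraicComplexity
open DirectSum

/-- **The irrelevant ideal of a graded ring over a field is maximal.** If every non-zero element
of `𝒜 0` is a unit, then `A₊ = {x | x₀ = 0}` is a maximal ideal of the (nontrivial) `ℕ`-graded
ring `A`: `1 ∉ A₊` as `1₀ = 1 ≠ 0`, and for `x ∉ A₊` the component `x₀` is a unit with
`x - x₀ ∈ A₊`, so any ideal strictly containing `A₊` and `x` contains `x₀`, hence `1`. [folklore] -/
theorem permQuot_irrelevant_isMaximal {A : Type*} [CommRing A] [Nontrivial A]
    (𝒜 : ℕ → AddSubgroup A) [GradedRing 𝒜] (h0 : ∀ a ∈ 𝒜 0, a ≠ 0 → IsUnit a) :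
    (HomogeneousIdeal.irrelevant 𝒜).toIdeal.IsMaximal := by
  rw [Ideal.isMaximal_iff]
  refine ⟨fun h1 => ?_, fun J x hJ hx hxJ => ?_⟩
  · rw [HomogeneousIdeal.mem_iff, HomogeneousIdeal.mem_irrelevant_iff, GradedRing.proj_apply,
      decompose_of_mem_same 𝒜 (SetLike.GradedOne.one_mem (A := 𝒜))] at h1
    exact one_ne_zero h1
  · have hu : IsUnit (decompose 𝒜 x 0 : A) :=
      Literature.RingTheory.RegularLocalRing.isUnit_decompose_zero_of_notMem 𝒜 h0 hx
    have hdiff : x - (decompose 𝒜 x 0 : A) ∈ (HomogeneousIdeal.irrelevant 𝒜).toIdeal := by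
      rw [HomogeneousIdeal.mem_iff, HomogeneousIdeal.mem_irrelevant_iff, GradedRing.proj_apply,
        decompose_sub, DirectSum.sub_apply, AddSubgroupClass.coe_sub,
        decompose_of_mem_same 𝒜 (SetLike.coe_mem (decompose 𝒜 x 0)), sub_self]
    have hx0J : (decompose 𝒜 x 0 : A) ∈ J := by
      have h := J.sub_mem hxJ (hJ hdiff)
      rwa [sub_sub_cancel] at h
    exact (Ideal.eq_top_iff_one J).mp (Ideal.eq_top_of_isUnit_mem J hx0J hu)

/-- **Graded descent of factoriality (Fossum 1973, Cor. 10.3), for a grading by submodules and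
factoriality at all maximal ideals.** If `A = ⨁ᵢ ℬ i` is a noetherian `ℕ`-graded domain whose
degree-`0` part is a field (every non-zero element of `ℬ 0` is a unit) and `A_M` is factorial for
every maximal ideal `M`, then `A` is factorial: the irrelevant ideal `A₊` is maximal
(`permQuot_irrelevant_isMaximal`), and Fossum's Cor. 10.3 — tree form
`uniqueFactorizationMonoid_of_atIrrelevant`, stated for gradings by additive subgroups, applied to
the same grading re-bundled (`𝒜 i := (ℬ i).toAddSubgroup`, same decomposition) — descends
factoriality from `A_{A₊}` to `A`. [cite: Fossum1973, Cor. 10.3] -/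
theorem permQuot_ufm_of_gradedAlgebra {R A : Type*} [CommRing R] [CommRing A] [Algebra R A]
    [IsDomain A] [IsNoetherianRing A] (ℬ : ℕ → Submodule R A) [GradedAlgebra ℬ]
    (h0 : ∀ a ∈ ℬ 0, a ≠ 0 → IsUnit a)
    (H : ∀ (M : Ideal A) [M.IsMaximal], UniqueFactorizationMonoid (Localization.AtPrime M)) :
    UniqueFactorizationMonoid A := by
  classical
  -- the same grading, by additive subgroups
  let 𝒜 : ℕ → AddSubgroup A := fun i => (ℬ i).toAddSubgroup
  letI : GradedRing 𝒜 :=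
    { one_mem := (SetLike.GradedOne.one_mem : (1 : A) ∈ ℬ 0)
      mul_mem := fun _ _ _ _ ha hb => SetLike.GradedMul.mul_mem (A := ℬ) ha hb
      decompose' := DirectSum.decompose ℬ
      left_inv := (DirectSum.decompose ℬ).left_inv
      right_inv := (DirectSum.decompose ℬ).right_inv }
  have h0' : ∀ a ∈ 𝒜 0, a ≠ 0 → IsUnit a := fun a ha => h0 a ha
  haveI hmax : (HomogeneousIdeal.irrelevant 𝒜).toIdeal.IsMaximal :=
    permQuot_irrelevant_isMaximal 𝒜 h0'
  haveI := H (HomogeneousIdeal.irrelevant 𝒜).toIdeal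
  exact Literature.RingTheory.RegularLocalRing.uniqueFactorizationMonoid_of_atIrrelevant 𝒜 h0'
    (HomogeneousIdeal.irrelevant 𝒜).toIdeal rfl

/-- **Stub 4 of line `derivation-symbolic-square` (graded descent, Fossum 1973 Cor. 10.3,
normality-free): locally factorial at the maximal ideals ⇒ `S_n` factorial.** For `n ≥ 3`,
`S_n = ℂ[x_{n×n}] ⧸ (per_n)` is a domain (`per_n` irreducible, `perPoly_irreducible`), noetherian,
and graded by total degree (`(per_n)` is homogeneous, `perPoly_isHomogeneous`; quotient grading
`quotGrading`) with degree-`0` part `ℂ`; if `(S_n)_M` is factorial for every maximal `M` then so is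
`S_n`, by `permQuot_ufm_of_gradedAlgebra` (`uniqueFactorizationMonoid_of_atIrrelevant` at the
maximal irrelevant ideal `(x̄_ij)`). [cite: Fossum1973, Cor. 10.3] -/
theorem stub_gradedDescent :
    ∀ n : ℕ, 3 ≤ n →
      (∀ (M : Ideal (MvPolynomial (Fin n × Fin n) ℂ ⧸ Ideal.span {perPoly (Fin n) ℂ})) [M.IsMaximal],
          ∃ _ : IsDomain (Localization.AtPrime M),
            UniqueFactorizationMonoid (Localization.AtPrime M)) →
        ∃ _ : IsDomain (MvPolynomial (Fin n × Fin n) ℂ ⧸ Ideal.span {perPoly (Fin n) ℂ}),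
          UniqueFactorizationMonoid (MvPolynomial (Fin n × Fin n) ℂ ⧸ Ideal.span {perPoly (Fin n) ℂ}) := by
  intro n hn H
  haveI : Nonempty (Fin n) := ⟨⟨0, by omega⟩⟩
  -- `S_n` is a domain: `per_n` is prime in the UFD `ℂ[x]`
  have hp : Prime (perPoly (Fin n) ℂ) :=
    UniqueFactorizationMonoid.irreducible_iff_prime.mp perPoly_irreducible
  haveI : (Ideal.span {perPoly (Fin n) ℂ}).IsPrime :=
    (Ideal.span_singleton_prime hp.ne_zero).mpr hp
  haveI hdom : IsDomain (MvPolynomial (Fin n × Fin n) ℂ ⧸ Ideal.span {perPoly (Fin n) ℂ}) :=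
    Ideal.Quotient.isDomain _
  refine ⟨hdom, ?_⟩
  -- `(per_n)` is homogeneous for the total-degree grading of `ℂ[x]`, so `S_n` is graded
  letI := MvPolynomial.gradedAlgebra (σ := Fin n × Fin n) (R := ℂ)
  have hhom : (Ideal.span {perPoly (Fin n) ℂ}).IsHomogeneous
      (homogeneousSubmodule (Fin n × Fin n) ℂ) :=
    Ideal.homogeneous_span _ _ fun x hx => by
      rw [Set.mem_singleton_iff] at hx
      subst hx
      exact ⟨_, (mem_homogeneousSubmodule _ _).2 perPoly_isHomogeneous⟩
  letI : GradedAlgebra (Literature.RingTheory.GradedAlgebra.quotGrading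
      (homogeneousSubmodule (Fin n × Fin n) ℂ) (Ideal.span {perPoly (Fin n) ℂ})) :=
    Literature.RingTheory.GradedAlgebra.quotGrading.gradedAlgebra
      (homogeneousSubmodule (Fin n × Fin n) ℂ) ⟨Ideal.span {perPoly (Fin n) ℂ}, hhom⟩
  refine permQuot_ufm_of_gradedAlgebra (Literature.RingTheory.GradedAlgebra.quotGrading
      (homogeneousSubmodule (Fin n × Fin n) ℂ) (Ideal.span {perPoly (Fin n) ℂ})) ?_ fun M _ => ?_
  · -- the degree-`0` part of `S_n` is (the image of) `ℂ`: non-zero elements are units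
    intro a ha ha0
    obtain ⟨c, hc, rfl⟩ := Literature.RingTheory.GradedAlgebra.mem_quotGrading_iff.1 ha
    rw [mem_homogeneousSubmodule] at hc
    have hcC : c = C (coeff 0 c) :=
      totalDegree_eq_zero_iff_eq_C.mp ((totalDegree_zero_iff_isHomogeneous _).mpr hc)
    have hr : coeff 0 c ≠ 0 := fun h => ha0 (by rw [hcC, h, C_0, map_zero])
    rw [hcC]
    exact ((isUnit_iff_ne_zero.mpr hr).map C).map _
  · -- factoriality at the maximal ideal `M`
    obtain ⟨_, hM⟩ := H M
    exact hM

end Summit.ValiantsHypothesis.Theorems.PermHypersurfaceFactorial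

end
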